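import Mathlib
import Summits.ValiantsHypothesis.ValiantsHypothesis.Theorems.GeneratorObstructionsPowGenDegreeQPDoublingGadget
import Summits.ValiantsHypothesis.ValiantsHypothesis.Theorems.GeneratorObstructionsGenFlipThesisChowDichotomy

/-!
# Route GeneratorObstructions — crux K2 `PowGenDegreeQP` (stmt-ValiantsHypothesis-11655), line
# `trace-side-regimes`: the doubling gadget is EASY, and K2 bounds it cell by cell

Companion of `…PowGenDegreeQPDoublingGadget` (arithmetic + stabiliser of the gadget
`g = Σ_{j<c} x_{B j}^k x_{A j}^{2k} x_{A' j}^{2k}` on interleaved letters `A j < B (j+1) < A' j`) and of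
`…PowGenDegreeQPEvaluationLateness` (evaluation lateness).

1. `gadget_late_genType_of_eval_ne_zero` — every highest-weight vector of NONCONSTANT weight not
   vanishing at `g` has `-|χ| ≥ 2^c`, and if one exists, `A(Δ_m g)` has a nonconstant GENERATOR TYPE
   with `-|χ| ≥ 2^c` (degree `≥ 2^c/m`).
2. `hasPowTraceRepr_add` / `hasPowTraceRepr_sum` (power traces add block-diagonally),
   `hasPowTraceRepr_gadgetMonomial`, `hasPowTraceRepr_gadget` — the gadget is a power trace of degree
   `5k` and size `5k · c`: `pc(g) ≤ 5k·c`, i.e. `g` lies in the SLICE of `Δ(tr X_n^{5k})` for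
   `n ≥ 5k·c` (GIP17 Prop. 5), well inside the quasi-polynomial window when `c ≍ k²`.
3. `powGenDegreeQP_gadget_bound` — **K2 ⇒** for every window exponent `c_w` some `c₀` with: in every
   gadget cell of the window (`5k·c ≤ 5k + e ≤ 2^((log₂ 5k + c_w)^c_w)`), IF one nonconstant
   semi-invariant is nonzero at `g` THEN `2^c ≤ 5k · 2^((log₂ 5k + c₀)^c₀)`.  With `c = 3k²`,
   `e = 5k(c-1)` (inside the window for `c_w = 2`) the left side is `2^{3k²}`: the Kempf–Hilbert–Mumford
   input for the gadget family (`-χ* = Σ_j 2^j (k e_{B j} + 2k e_{A j} + 2k e_{A' j}) ∈ cone(supp g)`,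
   Kempf 1978 Thm. 3.4/Cor. 3.5) would therefore REFUTE K2 and the registered `stub_sliceGen`.

Honest framing: unconditional facts about an explicit candidate + a conditional bound; the GIT input
is NOT proved here; no stub, crux or summit is settled; `VP ≠ VNP` untouched.
-/

namespace Summit.ValiantsHypothesis.ValiantsHypothesis.Theorems.GeneratorObstructions.PowGenDegreeQP

open MvPolynomial
open Literature.NumberTheory.DiophantineGeometry Literature.Computability.AlgebraicComplexity
  Literature.Barriers.ValiantsHypothesis
open Summit.ValiantsHypothesis.ValiantsHypothesis.Theses.GeneratorObstructions
open Summit.ValiantsHypothesis.ValiantsHypothesis.Theorems.GeneratorObstructions.SliceTransfer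
open Summit.ValiantsHypothesis.ValiantsHypothesis.Theorems.GeneratorObstructions.ChowDichotomy

-- `Summit.ValiantsHypothesis.ValiantsHypothesis.…` is the tree's mandated single-conjunct layout.
set_option linter.dupNamespace false

noncomputable section

/-! ## 1. Late generator type of the gadget from one nonvanishing semi-invariant -/

section Late

variable {σ : Type*} [Fintype σ] [LinearOrder σ] {c k : ℕ}

/-- **Late generator type of the gadget, given one nonvanishing nonconstant semi-invariant.**  For
the doubling gadget `g` (degree `m ≠ 0`) on interleaved letters: every highest-weight vector of
nonconstant weight not vanishing at `g` has `-|χ| ≥ 2^c`, and if one exists then `A(Δ_m g)` has a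
nonconstant generator type with `-|χ| ≥ 2^c` (degree `≥ 2^c / m`).  Occurring weights are antitone
and nonpositive (tree), so the package applies. [folklore] -/
theorem gadget_late_genType_of_eval_ne_zero (B A A' : Fin c → σ) (hc : 0 < c)
    (hBi : Function.Injective B) (hAi : Function.Injective A) (hA'i : Function.Injective A')
    (hBA : ∀ i j, B i ≠ A j) (hBA' : ∀ i j, B i ≠ A' j) (hAA' : ∀ i j, A i ≠ A' j)
    (hord1 : ∀ (j : Fin c) (h : j.val + 1 < c), A j < B ⟨j.val + 1, h⟩)
    (hord2 : ∀ (j : Fin c) (h : j.val + 1 < c), B ⟨j.val + 1, h⟩ < A' j)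
    (g : MvPolynomial σ ℂ) {m : ℕ} (hm : m ≠ 0)
    (hg : g = ∑ j : Fin c, X (B j) ^ k * (X (A j) ^ (2 * k) * X (A' j) ^ (2 * k)))
    (h2 : ∃ χ₀ : Weight σ, (∃ i j, χ₀ i ≠ χ₀ j) ∧
      ∃ x ∈ highestWeightSpace (orbitCoordRep g m) χ₀, evalAtPoint g m x ≠ 0) :
    ∃ χ : Weight σ, (∃ i j, χ i ≠ χ j) ∧ (2 : ℤ) ^ c ≤ -(Weight.size χ) ∧
      Module.finrank ℂ (↥(highestWeightSpace (orbitCoordRep g m) χ) ⧸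
        Submodule.comap (highestWeightSpace (orbitCoordRep g m) χ).subtype
          (⨆ p : Weight σ × Weight σ, ⨆ (_ : p.1 + p.2 = χ ∧ p.1 ≠ 0 ∧ p.2 ≠ 0),
            highestWeightSpace (orbitCoordRep g m) p.1 * highestWeightSpace (orbitCoordRep g m) p.2)) ≠ 0 := by
  classical
  haveI : Infinite ℂ := CharZero.infinite ℂ
  obtain ⟨S, hS, hpack⟩ := gadget_lateness_package B A A' hc hBi hAi hA'i hBA hBA' hAA' hord1 hord2 g hg
  -- `harith` in the form required, restricted to weights that can be seen at `g`: we route through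
  -- `exists_genType_of_not_le_ker_evalAtPoint` directly, using occurrence for antitonicity.
  refine exists_genType_of_not_le_ker_evalAtPoint g hm (fun χ => (2 : ℤ) ^ c ≤ -(Weight.size χ)) ?_ ?_
  · intro χ hnc hsmall x hx
    rw [LinearMap.mem_ker, AlgHom.toLinearMap_apply]
    by_cases hx0 : x = 0
    · rw [hx0, map_zero]
    have hocc : HasHighestWeight (orbitCoordRep g m) χ := by
      intro hbot
      rw [hbot, Submodule.mem_bot] at hx
      exact hx0 hx
    obtain ⟨hle, -⟩ := nonpos_and_exists_size_eq_of_hasHighestWeight_orbitCoordRep _ hocc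
    have hanti : Antitone χ := isDominant_of_hasHighestWeight_orbitCoordRep _ hocc
    have hne : χ ≠ 0 := by
      obtain ⟨i, j, hij⟩ := hnc
      intro h0
      rw [h0] at hij
      exact hij rfl
    by_cases hall : ∀ t ∈ S, weightChar χ t = 1
    · exact absurd (hpack χ hne hanti hle hall) hsmall
    · push Not at hall
      obtain ⟨t, htS, hχt⟩ := hall
      exact evalAtPoint_eq_zero_of_fix_of_weightChar_ne_one g m (hS t htS).1 (hS t htS).2 hx hχt
  · obtain ⟨χ₀, hnc, x, hx, hx0⟩ := h2
    exact ⟨χ₀, hnc, fun hle => hx0 (by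
      have := hle hx
      rwa [LinearMap.mem_ker, AlgHom.toLinearMap_apply] at this)⟩

end Late

/-! ## 3. The gadget is easy: a power-trace representation of size `5k · c` -/

section Easy

variable {σ : Type*}

/-- **Sums of power traces**: `tr(A₁^n) + tr(A₂^n) = tr((A₁ ⊕ A₂)^n)` — power-trace representations
add with sizes adding (block-diagonal matrix). Gesmundo–Ikenmeyer–Panova 2017 §2.2. [folklore] -/
theorem hasPowTraceRepr_add {f g : MvPolynomial σ ℂ} {n s₁ s₂ : ℕ} (hf : HasPowTraceRepr ℂ f n s₁)
    (hg : HasPowTraceRepr ℂ g n s₂) : HasPowTraceRepr ℂ (f + g) n (s₁ + s₂) := by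
  classical
  obtain ⟨A₁, hA₁, htr₁⟩ := hf
  obtain ⟨A₂, hA₂, htr₂⟩ := hg
  refine ⟨Matrix.reindex finSumFinEquiv finSumFinEquiv (Matrix.fromBlocks A₁ 0 0 A₂),
    fun i j => ?_, ?_⟩
  · rw [Matrix.reindex_apply, Matrix.submatrix_apply]
    rcases finSumFinEquiv.symm i with i' | i' <;> rcases finSumFinEquiv.symm j with j' | j'
    · rw [Matrix.fromBlocks_apply₁₁]; exact hA₁ _ _
    · rw [Matrix.fromBlocks_apply₁₂]; exact isHomogeneous_zero _ _ _
    · rw [Matrix.fromBlocks_apply₂₁]; exact isHomogeneous_zero _ _ _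
    · rw [Matrix.fromBlocks_apply₂₂]; exact hA₂ _ _
  · have hpow : (Matrix.reindex finSumFinEquiv finSumFinEquiv (Matrix.fromBlocks A₁ 0 0 A₂)) ^ n =
        Matrix.reindex finSumFinEquiv finSumFinEquiv ((Matrix.fromBlocks A₁ 0 0 A₂) ^ n) := by
      change (Matrix.reindexAlgEquiv ℂ _ finSumFinEquiv _) ^ n = Matrix.reindexAlgEquiv ℂ _ finSumFinEquiv _
      rw [map_pow]
    rw [hpow, trace_reindex, Matrix.fromBlocks_diagonal_pow, trace_fromBlocks', htr₁, htr₂]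

/-- The empty sum has a power-trace representation of size `0`. [folklore] -/
theorem hasPowTraceRepr_zero (n : ℕ) : HasPowTraceRepr ℂ (0 : MvPolynomial σ ℂ) n 0 := by
  refine ⟨0, fun i => Fin.elim0 i, ?_⟩
  unfold Matrix.trace
  simp

/-- **Finite sums of power traces of a common size** have a power-trace representation of size
`#s · s₀`. [folklore] -/
theorem hasPowTraceRepr_sum {ι : Type*} [DecidableEq ι] (s : Finset ι) (F : ι → MvPolynomial σ ℂ)
    {n s₀ : ℕ} (h : ∀ i ∈ s, HasPowTraceRepr ℂ (F i) n s₀) :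
    HasPowTraceRepr ℂ (∑ i ∈ s, F i) n (s.card * s₀) := by
  induction s using Finset.induction_on with
  | empty => simpa using hasPowTraceRepr_zero (σ := σ) n
  | insert a s ha ih =>
    rw [Finset.sum_insert ha, Finset.card_insert_of_notMem ha, add_one_mul, add_comm (s.card * s₀)]
    exact hasPowTraceRepr_add (h a (Finset.mem_insert_self a s))
      (ih fun i hi => h i (Finset.mem_insert_of_mem hi))

/-- The `5k` letters of a gadget monomial, listed with multiplicity, multiply to
`x_b^k x_a^{2k} x_{a'}^{2k}`. [folklore] -/
theorem prod_X_gadgetLetters (b a a' : σ) (k : ℕ) :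
    (∏ i : Fin (5 * k), (X (if i.val < k then b else if i.val < 3 * k then a else a') :
      MvPolynomial σ ℂ)) = X b ^ k * (X a ^ (2 * k) * X a' ^ (2 * k)) := by
  set f : ℕ → MvPolynomial σ ℂ := fun i => if i < k then X b else if i < 3 * k then X a else X a'
    with hf
  have h1 : (∏ i : Fin (5 * k), (X (if i.val < k then b else if i.val < 3 * k then a else a') :
      MvPolynomial σ ℂ)) = ∏ i ∈ Finset.range (5 * k), f i := by
    rw [← Fin.prod_univ_eq_prod_range]
    refine Finset.prod_congr rfl fun i _ => ?_
    simp only [hf]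
    split_ifs <;> rfl
  have hb : ∀ x ∈ Finset.range k, f x = X b := fun x hx => by
    rw [Finset.mem_range] at hx
    simp only [hf, if_pos hx]
  have ha : ∀ x ∈ Finset.range (2 * k), f (k + x) = X a := fun x hx => by
    rw [Finset.mem_range] at hx
    simp only [hf]
    rw [if_neg (by omega), if_pos (by omega)]
  have ha' : ∀ x ∈ Finset.range (2 * k), f (k + (2 * k + x)) = X a' := fun x hx => by
    rw [Finset.mem_range] at hx
    simp only [hf]
    rw [if_neg (by omega), if_neg (by omega)]
  rw [h1, show 5 * k = k + (2 * k + 2 * k) by ring, Finset.prod_range_add, Finset.prod_range_add,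
    Finset.prod_congr rfl hb, Finset.prod_congr rfl ha, Finset.prod_congr rfl ha',
    Finset.prod_const, Finset.prod_const, Finset.prod_const, Finset.card_range, Finset.card_range]

/-- **A gadget monomial is a power trace of size `5k`** (`k ≥ 1`): the weighted `5k`-cycle on its
letters with multiplicity (`hasPowTraceRepr_prod_X`). [folklore] -/
theorem hasPowTraceRepr_gadgetMonomial (b a a' : σ) {k : ℕ} (hk : 1 ≤ k) :
    HasPowTraceRepr ℂ (X b ^ k * (X a ^ (2 * k) * X a' ^ (2 * k)) : MvPolynomial σ ℂ) (5 * k) (5 * k) := by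
  have h := hasPowTraceRepr_prod_X (σ := σ) (m := 5 * k) (by omega)
    (fun i => if i.val < k then b else if i.val < 3 * k then a else a')
  rw [prod_X_gadgetLetters] at h
  exact h

/-- **The doubling gadget is easy**: `g = Σ_{j<c} x_{B j}^k x_{A j}^{2k} x_{A' j}^{2k}` has a
power-trace representation of degree `5k` and size `c · 5k` (block-diagonal cycles), so
`pc(g) ≤ 5k · c` — polynomial in the number of letters. [folklore] -/
theorem hasPowTraceRepr_gadget {c k : ℕ} (hk : 1 ≤ k) (B A A' : Fin c → σ) :
    HasPowTraceRepr ℂ (∑ j : Fin c, (X (B j) ^ k * (X (A j) ^ (2 * k) * X (A' j) ^ (2 * k)) :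
      MvPolynomial σ ℂ)) (5 * k) (c * (5 * k)) := by
  classical
  have h := hasPowTraceRepr_sum (σ := σ) (Finset.univ : Finset (Fin c))
    (fun j => X (B j) ^ k * (X (A j) ^ (2 * k) * X (A' j) ^ (2 * k))) (n := 5 * k) (s₀ := 5 * k)
    (fun j _ => hasPowTraceRepr_gadgetMonomial (B j) (A j) (A' j) hk)
  rwa [Finset.card_univ, Fintype.card_fin] at h

/-- The gadget is homogeneous of degree `5k`. [folklore] -/
theorem gadget_isHomogeneous {c : ℕ} (k : ℕ) (B A A' : Fin c → σ) :
    (∑ j : Fin c, (X (B j) ^ k * (X (A j) ^ (2 * k) * X (A' j) ^ (2 * k)) :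
      MvPolynomial σ ℂ)).IsHomogeneous (5 * k) := by
  refine IsHomogeneous.sum _ _ _ fun j _ => ?_
  have h := ((isHomogeneous_X ℂ (B j)).pow k).mul
    (((isHomogeneous_X ℂ (A j)).pow (2 * k)).mul ((isHomogeneous_X ℂ (A' j)).pow (2 * k)))
  convert h using 1
  ring

/-- The gadget is nonzero for `c ≥ 1` (it takes the value `c` at the all-ones point). [folklore] -/
theorem gadget_ne_zero {c : ℕ} (hc : 0 < c) (k : ℕ) (B A A' : Fin c → σ) :
    (∑ j : Fin c, (X (B j) ^ k * (X (A j) ^ (2 * k) * X (A' j) ^ (2 * k)) :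
      MvPolynomial σ ℂ)) ≠ 0 := by
  intro h
  have h1 := congrArg (MvPolynomial.eval (fun _ : σ => (1 : ℂ))) h
  simp only [map_sum, map_mul, map_pow, MvPolynomial.eval_X, one_pow, mul_one, Finset.sum_const,
    Finset.card_univ, Fintype.card_fin, nsmul_eq_mul, map_zero] at h1
  have : (c : ℂ) ≠ 0 := Nat.cast_ne_zero.mpr (by omega)
  exact this h1

end Easy

/-! ## 4. Consequence for the crux: K2 bounds the gadget — cell by cell -/

/-- **K2 ⇒ the doubling gadget cannot be semistable and late at once.**  `PowGenDegreeQP` implies: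
for every window exponent `c_w` there is `c₀` such that for every gadget cell — `k ≥ 1`, `c ≥ 1`
blocks placed on interleaved letters of the `(5k)²` matrix alphabet (injective, disjoint,
`A j < B (j+1) < A' j`), `e` with `5k · c ≤ 5k + e ≤ 2^((log₂ 5k + c_w)^c_w)` — IF some highest-weight
vector of nonconstant weight of `ℂ[Δ_{5k} g]` does not vanish at the gadget `g` (the
Kempf–Hilbert–Mumford input), THEN `2^c ≤ 5k · 2^((log₂ 5k + c₀)^c₀)`.  Since `c` may be taken
`≍ k²` inside the window (`3c + 1 ≤ 25k²`, `e = 5k·c`), the GIT input for the gadget family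
refutes K2 (`not_powGenDegreeQP_of_evalLate`).  Composition of `gadget_late_genType_of_eval_ne_zero`,
`hasPowTraceRepr_gadget` and the landed `genQP_of_powGenDegreeQP_of_hasPowTraceRepr`.
[cite: GesmundoIkenmeyerPanova2017, Prop. 5] -/
theorem powGenDegreeQP_gadget_bound (hK2 : PowGenDegreeQP) :
    ∀ c_w : ℕ, ∃ c₀ : ℕ, ∀ (k c e : ℕ), 1 ≤ k → 0 < c →
      5 * k + e ≤ 2 ^ ((Nat.log 2 (5 * k) + c_w) ^ c_w) → c * (5 * k) ≤ 5 * k + e →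
      ∀ (B A A' : Fin c → MatIdx (5 * k)),
        Function.Injective B → Function.Injective A → Function.Injective A' →
        (∀ i j, B i ≠ A j) → (∀ i j, B i ≠ A' j) → (∀ i j, A i ≠ A' j) →
        (∀ (j : Fin c) (h : j.val + 1 < c), A j < B ⟨j.val + 1, h⟩) →
        (∀ (j : Fin c) (h : j.val + 1 < c), B ⟨j.val + 1, h⟩ < A' j) →
        (∃ χ₀ : Weight (MatIdx (5 * k)), (∃ i j, χ₀ i ≠ χ₀ j) ∧
          ∃ x ∈ highestWeightSpace (orbitCoordRep
            (∑ j : Fin c, (X (B j) ^ k * (X (A j) ^ (2 * k) * X (A' j) ^ (2 * k)) :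
              MvPolynomial (MatIdx (5 * k)) ℂ)) (5 * k)) χ₀,
            evalAtPoint (∑ j : Fin c, (X (B j) ^ k * (X (A j) ^ (2 * k) * X (A' j) ^ (2 * k)) :
              MvPolynomial (MatIdx (5 * k)) ℂ)) (5 * k) x ≠ 0) →
        (2 : ℤ) ^ c ≤ ((5 * k : ℕ) : ℤ) * 2 ^ ((Nat.log 2 (5 * k) + c₀) ^ c₀) := by
  intro c_w
  obtain ⟨c₀, hc₀⟩ := genQP_of_powGenDegreeQP_of_hasPowTraceRepr hK2 c_w
  refine ⟨c₀, fun k c e hk hc hwin hce B A A' hBi hAi hA'i hBA hBA' hAA' hord1 hord2 hGIT => ?_⟩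
  set g : MvPolynomial (MatIdx (5 * k)) ℂ :=
    ∑ j : Fin c, (X (B j) ^ k * (X (A j) ^ (2 * k) * X (A' j) ^ (2 * k))) with hg
  have hrep : HasPowTraceRepr ℂ g (5 * k) (5 * k + e) :=
    HasPowTraceRepr.of_le (by omega) hce (hasPowTraceRepr_gadget hk B A A')
  obtain ⟨χ, -, hle, hγ⟩ := gadget_late_genType_of_eval_ne_zero B A A' hc hBi hAi hA'i hBA hBA' hAA'
    hord1 hord2 g (m := 5 * k) (by omega) hg hGIT
  have hb := hc₀ (5 * k) e (by omega) hwin g (gadget_isHomogeneous k B A A') (gadget_ne_zero hc k B A A')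
    hrep χ hγ
  exact hle.trans hb

end

end Summit.ValiantsHypothesis.ValiantsHypothesis.Theorems.GeneratorObstructions.PowGenDegreeQP
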